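import Summits.Ventures.PercRepro.S1CoreCapSevenThree
import Mathlib.Tactic.IntervalCases

/-!
# PercRepro — TOWARDS `Q*(7) = 19`: TWO BIG LINES IN A PLANE (p1, gen 26)

The case of exactly two lines `L₁, L₂` of `≥ 4` points lying in a common list of `lineRank ≤ 3` (two meeting big
lines always do; two disjoint ones may, through the hubs of chords) at nullity `7` — THE EXTREMAL CASE, `19`. The
plane on them (`exists_plane`) has `c ≤ 9` points (h5) and `u = |L₁ ∪ L₂| ∈ {7, …, 10}` of them on the big lines;
its other lines are CHORDS: 3-point lines with at most one point on each big line, hence through one of the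
`c − u ≤ 2` HUBS off the big lines (`exists_hub`). The chords through a hub are disjoint off it, so there are at
most `(c − 1) / 2` of them, and the chords through the second hub avoiding the first at most `(c − 2) / 2`
(`card_chords_le`); a fat point of the plane lies on at most `(c − 1) / 2` of its lines (`sum_fat_plane_le₃`);
outside, the thin family has budget `10 − c − f₀`. The table over `(|L₁|, |L₂|, u, c, f₀)` is at most `19`,
attained at `c = 9`, `u = 7`, `f₀ = 1`: two 4-point lines through a vertex, two hubs, seven chords, a fat hub on
four of them — the searches' maximiser (`sum_cap_le_nineteen_of_two_big_plane`). `proofs/P1-S4-CAPBRIDGE.md`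
§18 (iii). Axioms: standard.
-/

namespace PercRepro

namespace S1

namespace FourCap

namespace Seven

variable {β : Type} [DecidableEq β]

/-- **A point of a plane lies on at most `(c − 1) / 2` of its lines**, summed over the fat points: for a
duplicate-free list `l` of lines of `≥ 3` points pairwise sharing at most one point,
`Σ_{L ∈ l} fat L ≤ fat (unionL l) · ((|unionL l| − 1) / 2)`. -/
theorem sum_fat_plane_le₃ (w : β → ℕ) (l : List (Finset β)) (h3 : ∀ L ∈ l, 3 ≤ L.card)
    (hpair : ∀ L ∈ l, ∀ L' ∈ l, L ≠ L' → (L ∩ L').card ≤ 1) :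
    ∑ L ∈ l.toFinset, fat w L ≤ fat w (unionL l) * (((unionL l).card - 1) / 2) := by
  set P₀ := unionL l with hP₀
  have hsub : ∀ L ∈ l.toFinset, L ⊆ P₀ := fun L hL v hv => mem_unionL_iff.2 ⟨L, List.mem_toFinset.1 hL, hv⟩
  have hline : ∀ L ∈ l.toFinset, fat w L = ∑ p ∈ P₀.filter (fun u => w u = 2), if p ∈ L then 1 else 0 := by
    intro L hL
    unfold fat
    have e : L.filter (fun u => w u = 2) = (P₀.filter (fun u => w u = 2)).filter (fun p => p ∈ L) := by
      ext u
      simp only [Finset.mem_filter]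
      exact ⟨fun h => ⟨⟨hsub L hL h.1, h.2⟩, h.1⟩, fun h => ⟨h.2, h.1.2⟩⟩
    rw [e, Finset.card_filter]
  rw [Finset.sum_congr rfl hline, Finset.sum_comm]
  have hdeg : ∀ p ∈ P₀.filter (fun u => w u = 2),
      (∑ L ∈ l.toFinset, if p ∈ L then 1 else 0) ≤ (P₀.card - 1) / 2 := by
    intro p hp
    have hpP : p ∈ P₀ := (Finset.mem_filter.1 hp).1
    rw [← Finset.card_filter]
    set D := l.toFinset.filter (fun L => p ∈ L) with hD
    have hDmem : ∀ L ∈ D, L ∈ l ∧ p ∈ L := fun L hL => by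
      have h := Finset.mem_filter.1 hL
      exact ⟨List.mem_toFinset.1 h.1, h.2⟩
    have hdisj : ∀ L ∈ D, ∀ L' ∈ D, L ≠ L' → Disjoint (L.erase p) (L'.erase p) := by
      intro L hL L' hL' hne
      rw [Finset.disjoint_left]
      intro u hu hu'
      have h1 := Finset.mem_erase.1 hu
      have h2 := Finset.mem_erase.1 hu'
      have hint := hpair L (hDmem L hL).1 L' (hDmem L' hL').1 hne
      exact h1.1 (Finset.card_le_one.1 hint u (Finset.mem_inter.2 ⟨h1.2, h2.2⟩) p
        (Finset.mem_inter.2 ⟨(hDmem L hL).2, (hDmem L' hL').2⟩))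
    have hcard := Finset.card_biUnion hdisj
    have hsum : 2 * D.card ≤ ∑ L ∈ D, (L.erase p).card := by
      have h2 : ∀ L ∈ D, 2 ≤ (L.erase p).card := fun L hL => by
        rw [Finset.card_erase_of_mem (hDmem L hL).2]
        have := h3 L (hDmem L hL).1
        omega
      have := Finset.sum_le_sum h2
      rw [Finset.sum_const_nat (m := 2) (fun _ _ => rfl)] at this
      omega
    have hsub' : D.biUnion (fun L => L.erase p) ⊆ P₀.erase p := by
      intro u hu
      obtain ⟨L, hL, hu⟩ := Finset.mem_biUnion.1 hu
      have h := Finset.mem_erase.1 hu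
      exact Finset.mem_erase.2 ⟨h.1, hsub L (Finset.mem_filter.1 hL).1 h.2⟩
    have hle := Finset.card_le_card hsub'
    rw [hcard, Finset.card_erase_of_mem hpP] at hle
    omega
  refine (Finset.sum_le_sum hdeg).trans ?_
  rw [Finset.sum_const_nat (m := (P₀.card - 1) / 2) (fun _ _ => rfl)]
  rfl

/-- **Lines of a plane through a point avoiding another**: a finset `S` of 3-point lines inside `P₀`, pairwise
sharing at most one point, all through `h` and avoiding `h' ≠ h`, has `2 · #S + 2 ≤ |P₀|`. -/
theorem card_through_avoid_le {P₀ : Finset β} (S : Finset (Finset β)) (hS : ∀ X ∈ S, X.card = 3 ∧ X ⊆ P₀)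
    (hpair : ∀ X ∈ S, ∀ X' ∈ S, X ≠ X' → (X ∩ X').card ≤ 1) {h h' : β} (hh : h ∈ P₀) (hh' : h' ∈ P₀)
    (hne : h ≠ h') (hth : ∀ X ∈ S, h ∈ X) (hav : ∀ X ∈ S, h' ∉ X) : 2 * S.card + 2 ≤ P₀.card := by
  have hdisj : ∀ X ∈ S, ∀ X' ∈ S, X ≠ X' → Disjoint (X.erase h) (X'.erase h) := by
    intro X hX X' hX' hne'
    rw [Finset.disjoint_left]
    intro u hu hu'
    have h1 := Finset.mem_erase.1 hu
    have h2 := Finset.mem_erase.1 hu'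
    exact h1.1 (Finset.card_le_one.1 (hpair X hX X' hX' hne') u (Finset.mem_inter.2 ⟨h1.2, h2.2⟩) h
      (Finset.mem_inter.2 ⟨hth X hX, hth X' hX'⟩))
  have hcard := Finset.card_biUnion hdisj
  have hsum : ∑ X ∈ S, (X.erase h).card = 2 * S.card := by
    rw [Finset.sum_const_nat (m := 2) (fun X hX => by rw [Finset.card_erase_of_mem (hth X hX), (hS X hX).1])]
    ring
  have hsub : S.biUnion (fun X => X.erase h) ⊆ (P₀.erase h).erase h' := by
    intro u hu
    obtain ⟨X, hX, hu⟩ := Finset.mem_biUnion.1 hu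
    have hu' := Finset.mem_erase.1 hu
    exact Finset.mem_erase.2 ⟨fun e => hav X hX (e ▸ hu'.2), Finset.mem_erase.2 ⟨hu'.1, (hS X hX).2 hu'.2⟩⟩
  have hle := Finset.card_le_card hsub
  rw [hcard, hsum, Finset.card_erase_of_mem (Finset.mem_erase.2 ⟨hne.symm, hh'⟩),
    Finset.card_erase_of_mem hh] at hle
  have : 1 < P₀.card := Finset.one_lt_card.2 ⟨h, hh, h', hh', hne⟩
  omega

/-- **Lines of a plane through a point**: `2 · #S + 1 ≤ |P₀|` for a finset `S` of 3-point lines inside `P₀`,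
pairwise sharing at most one point, all through `h`. -/
theorem card_through_le {P₀ : Finset β} (S : Finset (Finset β)) (hS : ∀ X ∈ S, X.card = 3 ∧ X ⊆ P₀)
    (hpair : ∀ X ∈ S, ∀ X' ∈ S, X ≠ X' → (X ∩ X').card ≤ 1) {h : β} (hh : h ∈ P₀)
    (hth : ∀ X ∈ S, h ∈ X) : 2 * S.card + 1 ≤ P₀.card := by
  have hdisj : ∀ X ∈ S, ∀ X' ∈ S, X ≠ X' → Disjoint (X.erase h) (X'.erase h) := by
    intro X hX X' hX' hne'
    rw [Finset.disjoint_left]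
    intro u hu hu'
    have h1 := Finset.mem_erase.1 hu
    have h2 := Finset.mem_erase.1 hu'
    exact h1.1 (Finset.card_le_one.1 (hpair X hX X' hX' hne') u (Finset.mem_inter.2 ⟨h1.2, h2.2⟩) h
      (Finset.mem_inter.2 ⟨hth X hX, hth X' hX'⟩))
  have hcard := Finset.card_biUnion hdisj
  have hsum : ∑ X ∈ S, (X.erase h).card = 2 * S.card := by
    rw [Finset.sum_const_nat (m := 2) (fun X hX => by rw [Finset.card_erase_of_mem (hth X hX), (hS X hX).1])]
    ring
  have hsub : S.biUnion (fun X => X.erase h) ⊆ P₀.erase h := by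
    intro u hu
    obtain ⟨X, hX, hu⟩ := Finset.mem_biUnion.1 hu
    have hu' := Finset.mem_erase.1 hu
    exact Finset.mem_erase.2 ⟨hu'.1, (hS X hX).2 hu'.2⟩
  have hle := Finset.card_le_card hsub
  rw [hcard, hsum, Finset.card_erase_of_mem hh] at hle
  have : 1 ≤ P₀.card := Finset.card_pos.2 ⟨h, hh⟩
  omega

/-- **A chord has a hub**: a 3-point set inside `P₀` with at most one point on each of `L₁`, `L₂` has a point off
`L₁ ∪ L₂`. -/
theorem exists_hub {X L₁ L₂ : Finset β} (hX : X.card = 3) (h1 : (X ∩ L₁).card ≤ 1) (h2 : (X ∩ L₂).card ≤ 1) :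
    ∃ h ∈ X, h ∉ L₁ ∪ L₂ := by
  by_contra hc
  push Not at hc
  have hsub : X ⊆ (X ∩ L₁) ∪ (X ∩ L₂) := by
    intro v hv
    rcases Finset.mem_union.1 (hc v hv) with h | h
    · exact Finset.mem_union_left _ (Finset.mem_inter.2 ⟨hv, h⟩)
    · exact Finset.mem_union_right _ (Finset.mem_inter.2 ⟨hv, h⟩)
  have := Finset.card_le_card hsub
  have := Finset.card_union_le (X ∩ L₁) (X ∩ L₂)
  omega

/-- **The chords of a plane with two big lines**: a finset `S` of 3-point lines inside `P₀`, pairwise sharing at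
most one point, each meeting `L₁` and `L₂` in at most one point, with `L₁ ∪ L₂ ⊆ P₀`, has
`#S ≤ |P₀ ∖ (L₁ ∪ L₂)| · ((|P₀| − 1) / 2)` and, with at least two hubs, `#S ≤ (|P₀| − 1) / 2 + (|P₀| − 2) / 2`
when there are exactly two. -/
theorem card_chords_le {P₀ L₁ L₂ : Finset β} (S : Finset (Finset β))
    (hS : ∀ X ∈ S, X.card = 3 ∧ X ⊆ P₀ ∧ (X ∩ L₁).card ≤ 1 ∧ (X ∩ L₂).card ≤ 1)
    (hpair : ∀ X ∈ S, ∀ X' ∈ S, X ≠ X' → (X ∩ X').card ≤ 1) :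
    S.card ≤ (P₀ \ (L₁ ∪ L₂)).card * ((P₀.card - 1) / 2) ∧
      ((P₀ \ (L₁ ∪ L₂)).card = 2 → S.card ≤ (P₀.card - 1) / 2 + (P₀.card - 2) / 2) := by
  set H := P₀ \ (L₁ ∪ L₂) with hH
  have hhub : ∀ X ∈ S, ∃ h ∈ H, h ∈ X := by
    intro X hX
    obtain ⟨hX3, hXP, hX1, hX2⟩ := hS X hX
    obtain ⟨h, hhX, hh⟩ := exists_hub hX3 hX1 hX2
    exact ⟨h, Finset.mem_sdiff.2 ⟨hXP hhX, hh⟩, hhX⟩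
  have hcover : S ⊆ H.biUnion (fun h => S.filter (fun X => h ∈ X)) := by
    intro X hX
    obtain ⟨h, hh, hhX⟩ := hhub X hX
    exact Finset.mem_biUnion.2 ⟨h, hh, Finset.mem_filter.2 ⟨hX, hhX⟩⟩
  have hthrough : ∀ h ∈ H, 2 * (S.filter (fun X => h ∈ X)).card + 1 ≤ P₀.card := fun h hh =>
    card_through_le (S.filter (fun X => h ∈ X)) (fun X hX => ⟨(hS X (Finset.mem_filter.1 hX).1).1,
      (hS X (Finset.mem_filter.1 hX).1).2.1⟩)
      (fun X hX X' hX' hne => hpair X (Finset.mem_filter.1 hX).1 X' (Finset.mem_filter.1 hX').1 hne)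
      (Finset.mem_sdiff.1 hh).1 (fun X hX => (Finset.mem_filter.1 hX).2)
  refine ⟨?_, fun h2 => ?_⟩
  · refine (Finset.card_le_card hcover).trans ((Finset.card_biUnion_le).trans ?_)
    refine (Finset.sum_le_sum (fun h hh => (by have := hthrough h hh; omega :
      (S.filter (fun X => h ∈ X)).card ≤ (P₀.card - 1) / 2))).trans ?_
    rw [Finset.sum_const_nat (m := (P₀.card - 1) / 2) (fun _ _ => rfl)]
  · obtain ⟨h, h', hne, hH2⟩ := Finset.card_eq_two.1 h2
    have hh : h ∈ H := hH2 ▸ Finset.mem_insert_self h {h'}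
    have hh' : h' ∈ H := hH2 ▸ Finset.mem_insert_of_mem (Finset.mem_singleton_self h')
    have hsplit : S ⊆ S.filter (fun X => h ∈ X) ∪ S.filter (fun X => h' ∈ X ∧ h ∉ X) := by
      intro X hX
      obtain ⟨x, hx, hxX⟩ := hhub X hX
      by_cases hhX : h ∈ X
      · exact Finset.mem_union_left _ (Finset.mem_filter.2 ⟨hX, hhX⟩)
      · rw [hH2] at hx
        simp only [Finset.mem_insert, Finset.mem_singleton] at hx
        rcases hx with rfl | rfl
        · exact absurd hxX hhX
        · exact Finset.mem_union_right _ (Finset.mem_filter.2 ⟨hX, hxX, hhX⟩)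
    have h1 := hthrough h hh
    have h2' := card_through_avoid_le (S.filter (fun X => h' ∈ X ∧ h ∉ X))
      (fun X hX => ⟨(hS X (Finset.mem_filter.1 hX).1).1, (hS X (Finset.mem_filter.1 hX).1).2.1⟩)
      (fun X hX X' hX' hne' => hpair X (Finset.mem_filter.1 hX).1 X' (Finset.mem_filter.1 hX').1 hne')
      (Finset.mem_sdiff.1 hh').1 (Finset.mem_sdiff.1 hh).1 hne.symm
      (fun X hX => (Finset.mem_filter.1 hX).2.1) (fun X hX => (Finset.mem_filter.1 hX).2.2)
    have := Finset.card_le_card hsplit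
    have := Finset.card_union_le (S.filter (fun X => h ∈ X)) (S.filter (fun X => h' ∈ X ∧ h ∉ X))
    omega

/-! ### Two big lines in a plane -/

section TwoBig

variable {w : β → ℕ} {ls : Finset (Finset β)}
  (h1 : ∀ L ∈ ls, ∀ v ∈ L, w v = 1 ∨ w v = 2)
  (h2 : ∀ L ∈ ls, 3 ≤ L.card ∧ wsum w L ≤ 5)
  (h3 : ∀ L ∈ ls, ∀ L' ∈ ls, L ≠ L' → (L ∩ L').card ≤ 1)
  (h4 : ∀ l : List (Finset β), l.Nodup → (∀ L ∈ l, L ∈ ls) → wsum w (unionL l) ≤ 7 + lineRank l)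
  (h5 : ∀ l : List (Finset β), l.Nodup → (∀ L ∈ l, L ∈ ls) → lineRank l ≤ 3 → (unionL l).card ≤ 9)
  {L₁ L₂ : Finset β} (hL₁ : L₁ ∈ ls) (hL₂ : L₂ ∈ ls) (h12 : L₂ ≠ L₁)
  (c1 : 4 ≤ L₁.card) (c2 : 4 ≤ L₂.card)
  (hrest : ∀ L ∈ ls, L ≠ L₁ → L ≠ L₂ → L.card = 3)

omit [DecidableEq β] in
include h1 h2 in
/-- The cap of a big line of the spec is its number of points plus its fat points. -/
theorem capPaper_big_eq {A : Finset β} (hA : A ∈ ls) (cA : 4 ≤ A.card) :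
    capPaper A.card (fat w A) = A.card + fat w A := by
  have hw := wsum_eq_card_add_fat w A (h1 A hA)
  have h5' := (h2 A hA).2
  obtain ⟨-, c40, c50, -, c41, -⟩ := capPaper_values
  rcases (by omega : (A.card = 4 ∧ fat w A = 0) ∨ (A.card = 5 ∧ fat w A = 0) ∨ (A.card = 4 ∧ fat w A = 1))
    with ⟨hc, hf⟩ | ⟨hc, hf⟩ | ⟨hc, hf⟩ <;> rw [hc, hf] <;> assumption

include h1 h2 h3 h4 h5 hL₁ hL₂ h12 c1 c2 hrest in
/-- **Two big lines in a plane: cap sum `≤ 19`** — given a duplicate-free list `l₀` of lines of `ls` with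
`lineRank l₀ ≤ 3` containing `L₁` and `L₂`. -/
theorem sum_cap_le_nineteen_of_two_big_plane {l₀ : List (Finset β)} (hnd₀ : l₀.Nodup)
    (hls₀ : ∀ L ∈ l₀, L ∈ ls) (hr₀ : lineRank l₀ ≤ 3) (hl₁ : L₁ ∈ l₀) (hl₂ : L₂ ∈ l₀) :
    ∑ L ∈ ls, capPaper L.card (fat w L) ≤ 19 := by
  have h2' := two_le_card_of_spec₇ h2
  obtain ⟨l, hnd, hls, hr, hsub, hmax⟩ := exists_plane ls _ l₀ le_rfl hnd₀ hls₀ hr₀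
  have hc9 : (unionL l).card ≤ 9 := card_plane_le_nine h5 hnd hls hr
  have hL₁l : L₁ ∈ l := hsub L₁ hl₁
  have hL₂l : L₂ ∈ l := hsub L₂ hl₂
  have hU : L₁ ∪ L₂ ⊆ unionL l := by
    intro v hv
    rcases Finset.mem_union.1 hv with h | h
    · exact mem_unionL_iff.2 ⟨L₁, hL₁l, h⟩
    · exact mem_unionL_iff.2 ⟨L₂, hL₂l, h⟩
  have hu := Finset.card_union_add_card_inter L₁ L₂
  have p12 := h3 L₁ hL₁ L₂ hL₂ h12.symm
  have hcU := Finset.card_le_card hU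
  have hHc := Finset.card_sdiff_add_card_eq_card hU
  -- the cost of the plane: `c + f₀ ≤ 10`
  have hcs := wsum_unionL_eq w l (fun L hL => h1 L (hls L hL)) (fun L hL => h2' L (hls L hL))
  rw [wsum_eq_card_add_fat w (unionL l) (fun v hv => by
    obtain ⟨L, hL, hvL⟩ := mem_unionL_iff.1 hv
    exact h1 L (hls L hL) v hvL)] at hcs
  have hcost : (unionL l).card + fat w (unionL l) ≤ 10 := by
    have hb := costSum_le h1 h2' h4 l hnd hls
    omega
  -- the fat points of the plane
  have hfatin := sum_fat_plane_le₃ w l (fun L hL => (h2 L (hls L hL)).1)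
    (fun L hL L' hL' hne => h3 L (hls L hL) L' (hls L' hL') hne)
  -- the chords
  set S := (l.toFinset.erase L₁).erase L₂ with hS
  have hSmem : ∀ X ∈ S, X ∈ l ∧ X ≠ L₁ ∧ X ≠ L₂ := fun X hX => by
    have h2'' := Finset.mem_erase.1 hX
    have h1' := Finset.mem_erase.1 h2''.2
    exact ⟨List.mem_toFinset.1 h1'.2, h1'.1, h2''.1⟩
  have hchords := card_chords_le (L₁ := L₁) (L₂ := L₂) S (fun X hX => by
    obtain ⟨hXl, hX1, hX2⟩ := hSmem X hX
    exact ⟨hrest X (hls X hXl) hX1 hX2, fun v hv => mem_unionL_iff.2 ⟨X, hXl, hv⟩,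
      h3 X (hls X hXl) L₁ hL₁ hX1, h3 X (hls X hXl) L₂ hL₂ hX2⟩)
    (fun X hX X' hX' hne => h3 X (hls X (hSmem X hX).1) X' (hls X' (hSmem X' hX').1) hne)
  -- the thin family outside
  set T := ls.filter (fun L => L ∉ l) with hT
  have hTmem : ∀ L ∈ T, L ∈ ls ∧ L ∉ l := fun L hL => Finset.mem_filter.1 hL
  have hT3 : ∀ L ∈ T, L.card = 3 := fun L hL => hrest L (hTmem L hL).1
    (fun h => (hTmem L hL).2 (h ▸ hL₁l)) (fun h => (hTmem L hL).2 (h ▸ hL₂l))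
  have hk : ∀ t : List (Finset β), t.Nodup → (∀ L ∈ t, L ∈ T) →
      freeCountR (unionL l) t + fat w (unionLR (unionL l) t \ unionL l) ≤
        10 - (unionL l).card - fat w (unionL l) := by
    intro t hndt hlt
    have hb := budget_of_prefix h1 h2' h4 l t (by
      rw [List.nodup_append']
      exact ⟨hndt, hnd, fun L hLt hLl => (hTmem L (hlt L hLt)).2 hLl⟩)
      (fun L hL => by
        rcases List.mem_append.1 hL with hL | hL
        · exact (hTmem L (hlt L hL)).1
        · exact hls L hL)
      (fun L hL => hT3 L (hlt L hL))
    have hsplit := fat_sdiff_add_fat_of_subset w (subset_unionLR (unionL l) t)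
    omega
  have hthin := two_mul_sum_cap_thin_le w (unionL l) T
    (fun L hL => ⟨hT3 L hL, hmax L (hTmem L hL).1 (hTmem L hL).2⟩)
    (fun L hL L' hL' hne => h3 L (hTmem L hL).1 L' (hTmem L' hL').1 hne)
    (fun L hL => h1 L (hTmem L hL).1) (fun L hL => (h2 L (hTmem L hL).1).2) hk
  -- the sum
  have hsplit := Finset.sum_filter_add_sum_filter_not ls (fun L => L ∈ l) (fun L => capPaper L.card (fat w L))
  have hfil : ls.filter (fun L => L ∈ l) = l.toFinset := by
    ext L
    simp only [Finset.mem_filter, List.mem_toFinset]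
    exact ⟨fun h => h.2, fun h => ⟨hls L h, h⟩⟩
  rw [hfil, ← hT] at hsplit
  rw [← hsplit]
  have hL₁f : L₁ ∈ l.toFinset := List.mem_toFinset.2 hL₁l
  have hL₂f : L₂ ∈ l.toFinset.erase L₁ := Finset.mem_erase.2 ⟨h12, List.mem_toFinset.2 hL₂l⟩
  have esum : ∀ f : Finset β → ℕ, ∑ L ∈ l.toFinset, f L = f L₁ + (f L₂ + ∑ X ∈ S, f X) := by
    intro f
    rw [← Finset.add_sum_erase _ f hL₁f, ← Finset.add_sum_erase _ f hL₂f]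
  have hcap3 : ∀ X ∈ S, capPaper X.card (fat w X) = 1 + fat w X := by
    intro X hX
    obtain ⟨hXl, hX1, hX2⟩ := hSmem X hX
    have hXls := hls X hXl
    have := wsum_eq_card_add_fat w X (h1 X hXls)
    have := (h2 X hXls).2
    have hXc := hrest X hXls hX1 hX2
    rw [hXc, capPaper_three_eq' (by omega)]
  rw [esum, capPaper_big_eq h1 h2 hL₁ c1, capPaper_big_eq h1 h2 hL₂ c2, Finset.sum_congr rfl hcap3,
    Finset.sum_add_distrib, Finset.sum_const_nat (m := 1) (fun _ _ => rfl), Nat.mul_one]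
  rw [esum] at hfatin
  -- the table
  have hw1 := (h2 L₁ hL₁).2
  have hw2 := (h2 L₂ hL₂).2
  have hwa := wsum_eq_card_add_fat w L₁ (h1 L₁ hL₁)
  have hwb := wsum_eq_card_add_fat w L₂ (h1 L₂ hL₂)
  obtain ⟨hch1, hch2⟩ := hchords
  generalize hc : (unionL l).card = c at hfatin hthin hcost hc9 hcU hHc hch1 hch2
  generalize hf : fat w (unionL l) = f₀ at hfatin hthin hcost
  generalize (unionL l \ (L₁ ∪ L₂)).card = hh at hHc hch1 hch2
  generalize (L₁ ∪ L₂).card = u at hu hcU hHc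
  generalize L₁.card = k1 at c1 hw1 hwa hu ⊢
  generalize L₂.card = k2 at c2 hw2 hwb hu ⊢
  generalize (L₁ ∩ L₂).card = i at p12 hu
  generalize S.card = s at hch1 hch2 ⊢
  generalize fat w L₁ = a at hwa hfatin ⊢
  generalize fat w L₂ = b at hwb hfatin ⊢
  generalize ∑ X ∈ S, fat w X = d at hfatin ⊢
  generalize ∑ L ∈ T, capPaper L.card (fat w L) = e at hthin ⊢
  have hk1 : k1 ≤ 5 := by omega
  have hk2 : k2 ≤ 5 := by omega
  have hf5 : f₀ ≤ 3 := by omega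
  have hh2 : hh ≤ 2 := by omega
  interval_cases k1 <;> interval_cases k2 <;> interval_cases hh <;> interval_cases c <;> interval_cases f₀ <;> omega

end TwoBig

end Seven

end FourCap

end S1

end PercRepro
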